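import Summits.BirchSwinnertonDyer.BirchSwinnertonDyer.Theorems.ManinLocalTwoThreeCDivisionOddSquarefreeResidual

/-!
# S6′ probe (bsd-idea-19 g38, dual lens; LOCAL CHECK ONLY — not proposed, not an item; W-71/W-79)

Modulo CDT, no integer `m ≥ 3` divides the Manin constant of a lattice-optimal `X₀(N)`-datum, at EVERY level `N`,
from four EXISTING tree lemmas and WITHOUT Atkin–Lehner `a_p = 0` / Ling–Oesterlé `U_p = p`:
`(conj − 1)Λ₀ ⊆ Λ₁(f) ⊆ Λ_W = c·Λ₀`, so `conj ≡ id` on `Λ₀/mΛ₀`, excluded for `m ≥ 3`.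
Corollaries: `|c| ≤ 2` at every level (mod CDT), and C5 `ManinPrimeToAdditiveFiveLe` by name.
No summit statement is proved by this file; everything is conditional on the vendored printed CDT theorem.
-/

set_option autoImplicit false

noncomputable section

open scoped MatrixGroups ModularForm Manifold ComplexConjugate
open CongruenceSubgroup
open WeierstrassCurve Literature.NumberTheory.EllipticCurves Literature.NumberTheory.EllipticCurves.ModularForms
open Literature.NumberTheory.Automorphic
open Summit.BirchSwinnertonDyer.BirchSwinnertonDyer.Theorems.ManinLocalTwoThree

namespace H21Probe.BsdIdea19.S6prime

variable {W : WeierstrassCurve ℚ} [W.IsElliptic] [W.IsGloballyMinimal] {N : ℕ} [NeZero N]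

/-- S6′: modulo CDT, `m ∤ c` for every `m ≥ 3`, at every level, for a lattice-optimal datum. -/
theorem not_dvd_maninConstant_of_CDT_of_three_le
    (hCDT : CalegariDimitrovTang2025_unboundedDenominators_algInt) (D : ModularParametrizationData W N)
    (hopt : ∀ z ∈ D.L.lattice, ∃ w ∈ periodLattice D.f, z = D.c * w) {m : ℕ} (hm : 3 ≤ m) :
    ¬ (m : ℤ) ∣ D.maninConstant := by
  rintro ⟨k, hk⟩
  have hk' : D.c = m * k := hk
  have hle := CDivisionUDC.periodLatticeGamma1_le_neron_of_CDT hCDT D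
  have hreal : ∀ n, (cuspCoeff D.f n).im = 0 := D.isNewformOf.1.cuspCoeff_im_eq_zero
  refine false_of_conj_sub_self_mem_natCast_mul D.L hm
    (conj_sub_self_mem_natCast_mul_lattice_of_periodLattice D hopt fun z hz ↦ ?_)
  -- `conj z − z ∈ Λ₁(f) ⊆ Λ_W = c·Λ₀(f)` and `c = m k`
  obtain ⟨w, hw, hzw⟩ := hopt _ (hle _ (conj_sub_self_mem_periodLatticeGamma1 hreal hz))
  refine ⟨(k : ℂ) * w, ?_, ?_⟩
  · simpa [zsmul_eq_mul] using zsmul_mem hw k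
  · rw [hzw, hk']; push_cast; ring

/-- Corollary: `|c| ≤ 2` at EVERY level, modulo CDT (the tree's `natAbs_maninConstant_le_two_of_CDT` carries `2² ∣ N`). -/
theorem natAbs_maninConstant_le_two_of_CDT_allLevels
    (hCDT : CalegariDimitrovTang2025_unboundedDenominators_algInt) (D : ModularParametrizationData W N)
    (hopt : ∀ z ∈ D.L.lattice, ∃ w ∈ periodLattice D.f, z = D.c * w) :
    D.maninConstant.natAbs ≤ 2 := by
  by_contra h
  have h3 : 3 ≤ D.maninConstant.natAbs := by omega
  exact not_dvd_maninConstant_of_CDT_of_three_le hCDT D hopt h3 (Int.natAbs_dvd.mpr (dvd_refl _))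

/-- Corollary: C5 by name, modulo CDT, via S6′ (no Atkin–Lehner, no `U_p = p`). -/
theorem maninPrimeToAdditiveFiveLe_of_CDT_viaConj
    (hCDT : CalegariDimitrovTang2025_unboundedDenominators_algInt) :
    Summit.BirchSwinnertonDyer.BirchSwinnertonDyer.Theses.ManinLocalTwoThree.ManinPrimeToAdditiveFiveLe := by
  intro _ _ _ _ W _ _ N _ D hopt p _ h5 _
  exact not_dvd_maninConstant_of_CDT_of_three_le hCDT D hopt (by omega)

#print axioms maninPrimeToAdditiveFiveLe_of_CDT_viaConj

end H21Probe.BsdIdea19.S6prime
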